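import Summits.QuantumFields.BalabanUV.Beta.GAN24.FirstOrderModelRealLetters
import Summits.QuantumFields.BalabanUV.Beta.GAN24.StaircaseLineSumDefect
import Summits.QuantumFields.BalabanUV.Beta.GAN24.EffectiveFormLocalisation
import Literature.MathematicalPhysics.QuantumFieldTheory.Balaban1983to89.Beta.VectorTailsCov

/-!
# `BalabanUV.Beta.GAN24.OneStepConstraintLetters` — binder row G-an2-4 ∕ (CONV-C), routes C-R6° («VALUES») × R7 («TWO CURRENCIES»), PART 168:
# THE ONE-STEP CONSTRAINT LETTERS OF BAŁABAN's AVERAGING `QB N R M`, I — its entries through the block parent, block support (`par x′ ∈ {y, y + e_μ}`,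
# `tdist(y, par x′) ≤ 1`), the mask value, row mass `1` and column mass `R^{−d}`, and an explicit RIGHT INVERSE (the corner lift, mass `R^{2d}`):
# PART 105's `hUB` and `q₁` letters for the constraint `Q̃ = re QB`, generically in `(N, R, M)` (unit b2b-balaban-gan24-p3, gen 58; v1)

NOT IN PRINT; OUR PROOF ([folklore] torus-block combinatorics BY NAME over NE2's `BalabanLineAverage.QB_apply` ((1.11) ∕ (1.18) entrywise),
`BalabanAveragedTowerModes` (`par ∕ rem`, the block decomposition `x′ = R·par x′ + rem x′`, `QB·J₀′ = J₀`, `QBᴴ·J₀ = R^{−d}J₀′`), `BalabanAveragedTowerApply.eq_par_rem_of_eq'`,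
road P2's `StaircaseLineSumDefect.par_sub_tstep_lt` («`t < R` fine steps back leave the parent unchanged iff `t ≤ rem_μ`»), b05's `B5RealFields` (`reM`, `IsReal`), PART 167
`isReal_QB` and `Beta.VectorTailsCov.tdist` (`tdist_add_unitVec_le`).  [Balaban1984PropagatorsI] (1.11) p. 19, (1.18) p. 20 LOCATE the object; nothing printed is a hypothesis.)
HONEST FRAMING (cell contract, verbatim): «discharging `BetaPertH` makes Bałaban's UV stability UNCONDITIONAL — a real constructive-QFT result; it is NOT the continuum limit
and NOT the Clay problem.»  HONEST DEPENDENCY (verbatim): «continuum YM on T⁴ ⇐ BetaPertH ∧ nine spine estimates (0/9 proved); BetaPertH ⇐ (D1) ∧ (D4) ∧ CAP+tail; G-an2-4 gates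
asym, D1 and NE2/3/4.»

WHY (census V195 ∕ V197, gen 57).  After PARTs 164–167 the one-loop polarization (1.20) of the lineage's model is «½·BUBBLE − ½·TADPOLE» against an2's `flucCov (c_k⁻¹ + S₀) Q̃` for ANY real
background-independent constraint `Q̃`; what separates it from the `LimitRate` END is the letter `𝒢 = flucCov(Σ, Q̃)` in the INPUT-triple currency, which the lineage's own PARTs 105 ∕ 106 ∕ 114
deliver from letters ON THE CONSTRAINT — row mass `q₁`, block compatibilities (`ρ`, `D`, `σ`), the upper bound in trial form `hUB` (a right inverse of `Q̃` with controlled mass), the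
coercivity `hK` — plus model-side inputs.  Under EITHER typing option of V197 the constraint is Bałaban's ONE-STEP averaging: (i) `QB 1 L (cubic s′)`, (ii) `QBlev L M 0`, and
`QBlev L M k = QB (lev L k) L M` for every `k` by `rfl`.  THIS FILE supplies those letters for `QB N R M` GENERICALLY in `(N, R, M)`, so the choice costs nothing downstream; the companion
`OneStepConstraintLettersReg` (PART 169) adds the block compatibilities in PART 105 §4's literal shape, the regulariser `(re QB)ᵀ(a•1)(re QB)`, and «kernel coercivity ⟹ `hK`».

WHAT THIS FILE PROVES (0 sorry, 0 `def`; `N, R ≥ 1`, every torus `M`, every `d`; coarse bonds `(y,μ) ∈ Tor (fine N M) × Fin d`, fine bonds `(x′,μ′) ∈ Tor (fine (R·N) M) × Fin d`):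
* §1 `sum_ite_eq_cpt_add_off`; **`QB_apply_eq_sum_par`** (`QB_{(y,μ),(x′,μ′)} = δ_{μμ′}R^{−(d+1)}·#{t < R : par(x′ − t·e′_μ) = y}`), `QB_eq_zero_of_ne`, `QB_apply_eq_card`; **`par_of_QB_ne_zero`**
  (support: `μ′ = μ`, `par x′ ∈ {y, y + e_μ}`), **`tdist_par_le_one_of_QB_ne_zero`**; **`QB_apply_of_rem_eq`** (mask `rem_μ x′ = R − 1`: `QB = R^{−d}·[par x′ = y]`); `ofReal_re_QB`,
  `re_QB_eq_card`, `re_QB_nonneg`, `re_QB_le` (`0 ≤ QB ≤ R^{−d}` entrywise).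
* §2 **`sum_QB_row`** (`= 1`), **`sum_QB_col`** (`= R^{−d}`), `sum_re_QB_row`, **`sum_abs_reM_QB_row`** (PART 105 §4's `q₁ = 1`), `sum_re_QB_col`.
* §3 `sum_eq_sum_par_off` (reparametrisation by (parent, offset)), `sum_ite_forall_eq`; the CORNER LIFT `u(x′,μ) = [rem x′ ≡ R−1]·R^d·B(par x′, μ)` (spelled inline):
  **`reM_QB_mulVec_cornerLift`** (`(re QB)·u = B`), **`cornerLift_dotProduct_self`** (`|u|² = R^{2d}|B|²`), **`ub_QB`** (PART 105 ∕ 106's `hUB` with `Λ = h·R^{2d}` from `⟨u,Hu⟩ ≤ h|u|²`),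
  **`dotProduct_self_le_transpose_QB`** (`|B|² ≤ R^{2d}|(re QB)ᵀB|²`: onto, quantitatively).
WHAT IT IS NOT: no fine form `H` is touched (the model-side letters of V195 — `re Σ` PSD, its kernel coercivity on `ker QB`, its entry decay — are the adapter's); no choice between (i) ∕ (ii)
is made; nothing k-uniform is claimed beyond what `R = L` fixed gives.  SUPPLIER work; no consumer of record yet; NEVER «G-an2-4 closed»; NOT (CONV-C), NOT D1, NOT `BetaPertH`, NOT
continuum, NOT Clay.  Records: `HOME/b2b-balaban-gan24-p3/gen58/README.md`.
-/

noncomputable section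

open scoped BigOperators ComplexConjugate Matrix
open Finset Matrix

namespace Summit.QuantumFields.BalabanUV.Beta.GAN24.OneStepConstraintLetters

open Literature.MathematicalPhysics.QuantumFieldTheory.Balaban1983to89
open Literature.MathematicalPhysics.QuantumFieldTheory.Balaban1983to89.B5Prop11Plancherel (Tor fine unitVec)
open Literature.MathematicalPhysics.QuantumFieldTheory.Balaban1983to89.B5Block118 (tstep)
open Literature.MathematicalPhysics.QuantumFieldTheory.Balaban1983to89.B5G183RateTorus (cpt)
open Literature.MathematicalPhysics.QuantumFieldTheory.Balaban1983to89.B5G183RateTorusW (off)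
open Literature.MathematicalPhysics.QuantumFieldTheory.Balaban1983to89.B5RealFields (IsReal reM reM_apply)
open Literature.MathematicalPhysics.QuantumFieldTheory.Balaban1983to89.Beta.VectorTailsCov (tdist tdist_self tdist_triangle tdist_comm tdist_add_unitVec_le)
open Summit.QuantumFields.BalabanUV.T4Continuum.BalabanLineAverage (QB QB_apply)
open Summit.QuantumFields.BalabanUV.T4Continuum.BalabanAveragedTowerModes (par rem constV cpt_par_add_off_rem par_cpt_add_off rem_cpt_add_off
  QB_mulVec_constV QB_conjTranspose_mulVec_constV)
open Summit.QuantumFields.BalabanUV.T4Continuum.BalabanAveragedTowerApply (eq_par_rem_of_eq')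
open Summit.QuantumFields.BalabanUV.Beta.GAN24.StaircaseLineSumDefect (par_sub_tstep_lt)
open Summit.QuantumFields.BalabanUV.Beta.GAN24.FirstOrderModelRealLetters (isReal_QB)

variable {d : ℕ} (N R : ℕ) [NeZero N] [NeZero R] (M : Fin d → ℕ) [hM : ∀ μ, NeZero (M μ)]

/-! ## §1 The entries of `QB` through the block parent -/

section Entries

/-- `Σ_j [w = R·z + j] = [par w = z]`: a fine site lies in the `R`-block of the coarse site `z` iff its block parent is `z`, and then with exactly one
offset (`rem w`). [folklore] -/
theorem sum_ite_eq_cpt_add_off (z : Tor (fine N M)) (w : Tor (fine (R * N) M)) :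
    ∑ j : Fin d → Fin R, (if w = cpt N R M z + off N R M j then (1 : ℂ) else 0) = if par N R M w = z then 1 else 0 := by
  by_cases hz : par N R M w = z
  · rw [if_pos hz, Finset.sum_eq_single (rem N R M w)]
    · rw [if_pos]
      rw [← hz]
      exact (cpt_par_add_off_rem N R M w).symm
    · intro j _ hj
      rw [if_neg]
      intro h
      exact hj (eq_par_rem_of_eq' N R M h).2
    · intro h; exact absurd (Finset.mem_univ _) h
  · rw [if_neg hz]
    refine Finset.sum_eq_zero fun j _ => ?_
    rw [if_neg]
    intro h
    exact hz (eq_par_rem_of_eq' N R M h).1.symm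

/-- **`QB_apply_eq_sum_par` — THE ENTRIES OF BAŁABAN's ONE-STEP AVERAGING THROUGH THE BLOCK PARENT**:
`QB_{(y,μ),(x′,μ′)} = δ_{μμ′}·R^{−(d+1)}·#{t < R : par(x′ − t·e′_μ) = y}` — the fine bond `(x′, μ)` lies on the `R` straight contours `[x, x + R·e′_μ]` starting at
`x = x′ − t·e′_μ`, `t < R`, and such a contour is counted in `(QA)_{(y,μ)}` iff `x ∈ B(y)`, i.e. iff `par x = y` ((1.11) ∕ (1.18) read bond by bond).
[cite: Balaban1984PropagatorsI, (1.11) p.19, (1.18) p.20] [folklore] -/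
theorem QB_apply_eq_sum_par (i : Tor (fine N M) × Fin d) (x : Tor (fine (R * N) M) × Fin d) :
    QB N R M i x = if x.2 = i.2 then
      ((R : ℂ) ^ (d + 1))⁻¹ * ∑ t : Fin R, (if par N R M (x.1 - tstep (fine (R * N) M) x.2 (t : ℕ)) = i.1 then (1 : ℂ) else 0)
      else 0 := by
  obtain ⟨y, μ⟩ := i
  obtain ⟨w, μ'⟩ := x
  rw [QB_apply, Finset.sum_comm]
  dsimp only
  by_cases hμ : μ' = μ
  · rw [hμ, if_pos rfl]
    congr 1
    refine Finset.sum_congr rfl fun t _ => ?_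
    rw [← sum_ite_eq_cpt_add_off N R M y (w - tstep (fine (R * N) M) μ (t : ℕ))]
    refine Finset.sum_congr rfl fun j _ => ?_
    by_cases h : w - tstep (fine (R * N) M) μ (t : ℕ) = cpt N R M y + off N R M j
    · rw [if_pos h, if_pos]
      rw [Prod.mk.injEq]
      exact ⟨sub_eq_iff_eq_add.mp h, rfl⟩
    · rw [if_neg h, if_neg]
      intro h'
      apply h
      rw [Prod.mk.injEq] at h'
      exact sub_eq_iff_eq_add.mpr h'.1
  · rw [if_neg hμ]
    refine mul_eq_zero_of_right _ (Finset.sum_eq_zero fun t _ => Finset.sum_eq_zero fun j _ => ?_)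
    rw [if_neg]
    intro h
    rw [Prod.mk.injEq] at h
    exact hμ h.2

/-- `QB` is diagonal in the component: `QB_{(y,μ),(x′,μ′)} = 0` for `μ′ ≠ μ`. [folklore] -/
theorem QB_eq_zero_of_ne {i : Tor (fine N M) × Fin d} {x : Tor (fine (R * N) M) × Fin d} (h : x.2 ≠ i.2) : QB N R M i x = 0 := by
  rw [QB_apply_eq_sum_par, if_neg h]

/-- the counting form: `QB_{(y,μ),(x′,μ)} = R^{−(d+1)}·#{t < R : par(x′ − t·e′_μ) = y}`. [folklore] -/
theorem QB_apply_eq_card (i : Tor (fine N M) × Fin d) (x : Tor (fine (R * N) M) × Fin d) :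
    QB N R M i x = if x.2 = i.2 then ((R : ℂ) ^ (d + 1))⁻¹ *
      ((Finset.univ.filter fun t : Fin R => par N R M (x.1 - tstep (fine (R * N) M) x.2 (t : ℕ)) = i.1).card : ℂ) else 0 := by
  rw [QB_apply_eq_sum_par, Finset.sum_boole (R := ℂ)]

/-- **BLOCK SUPPORT**: `QB_{(y,μ),(x′,μ′)} ≠ 0` forces `μ′ = μ` and `par x′ ∈ {y, y + e_μ}` — a fine bond on a contour counted at `(y, μ)` lies in the block of `y` or in the
next block in its own direction. [folklore] -/
theorem par_of_QB_ne_zero {i : Tor (fine N M) × Fin d} {x : Tor (fine (R * N) M) × Fin d} (h : QB N R M i x ≠ 0) :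
    x.2 = i.2 ∧ (par N R M x.1 = i.1 ∨ par N R M x.1 = i.1 + unitVec (fine N M) i.2) := by
  rw [QB_apply_eq_sum_par] at h
  by_cases hμ : x.2 = i.2
  · refine ⟨hμ, ?_⟩
    rw [if_pos hμ] at h
    have h' : ∑ t : Fin R, (if par N R M (x.1 - tstep (fine (R * N) M) x.2 (t : ℕ)) = i.1 then (1 : ℂ) else 0) ≠ 0 := by
      intro h0; apply h; rw [h0, mul_zero]
    obtain ⟨t, -, ht⟩ := Finset.exists_ne_zero_of_sum_ne_zero h'
    have ht' : par N R M (x.1 - tstep (fine (R * N) M) x.2 (t : ℕ)) = i.1 := by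
      by_contra hc; exact ht (if_neg hc)
    rw [par_sub_tstep_lt N R M x.1 x.2 t.isLt] at ht'
    split_ifs at ht' with hle
    · exact Or.inl ht'
    · right
      rw [← hμ, ← ht', sub_add_cancel]
  · exact absurd (by rw [if_neg hμ]) h

/-- the block support in the torus sup-distance of the coarse lattice (`VectorTailsCov.tdist`): `QB_{(y,μ),(x′,μ′)} ≠ 0 ⟹ tdist(y, par x′) ≤ 1`. [folklore] -/
theorem tdist_par_le_one_of_QB_ne_zero {i : Tor (fine N M) × Fin d} {x : Tor (fine (R * N) M) × Fin d} (h : QB N R M i x ≠ 0) :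
    tdist i.1 (par N R M x.1) ≤ 1 := by
  obtain ⟨-, hp | hp⟩ := par_of_QB_ne_zero N R M h
  · rw [hp, tdist_self]; exact zero_le_one
  · rw [hp]; exact tdist_add_unitVec_le (fine N M) i.1 i.2

/-- **THE MASK VALUE**: on a fine bond in the LAST hyperplane of its block in its own direction (`rem_μ x′ = R − 1`) all `R` contours through it start in the
same block, so `QB_{(y,μ),(x′,μ)} = R^{−d}·[par x′ = y]`. [folklore] -/
theorem QB_apply_of_rem_eq {i : Tor (fine N M) × Fin d} {x : Tor (fine (R * N) M) × Fin d} (hx : (rem N R M x.1 x.2 : ℕ) = R - 1) :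
    QB N R M i x = if (par N R M x.1, x.2) = i then ((R : ℂ) ^ d)⁻¹ else 0 := by
  have hR : (R : ℂ) ≠ 0 := by exact_mod_cast NeZero.ne R
  rw [QB_apply_eq_sum_par]
  have hall : ∀ t : Fin R, par N R M (x.1 - tstep (fine (R * N) M) x.2 (t : ℕ)) = par N R M x.1 := by
    intro t
    rw [par_sub_tstep_lt N R M x.1 x.2 t.isLt, if_pos]
    rw [hx]; have := t.isLt; omega
  simp_rw [hall]
  by_cases hμ : x.2 = i.2
  · by_cases hp : par N R M x.1 = i.1
    · rw [if_pos hμ, if_pos (Prod.ext hp hμ)]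
      simp only [if_pos hp, Finset.sum_const, Finset.card_univ, Fintype.card_fin, nsmul_eq_mul, mul_one]
      rw [pow_succ, mul_inv, mul_assoc, inv_mul_cancel₀ hR, mul_one]
    · rw [if_pos hμ, if_neg (fun h => hp (congrArg Prod.fst h))]
      simp [hp]
  · rw [if_neg hμ, if_neg (fun h => hμ (congrArg Prod.snd h))]

/-- the entries of `QB` are real: `((re QB_{ix}) : ℂ) = QB_{ix}`. [folklore] -/
theorem ofReal_re_QB (i : Tor (fine N M) × Fin d) (x : Tor (fine (R * N) M) × Fin d) : (((QB N R M i x).re : ℝ) : ℂ) = QB N R M i x :=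
  (isReal_QB N R M).coe_reM i x

/-- the real part in counting form. [folklore] -/
theorem re_QB_eq_card (i : Tor (fine N M) × Fin d) (x : Tor (fine (R * N) M) × Fin d) :
    (QB N R M i x).re = if x.2 = i.2 then ((R : ℝ) ^ (d + 1))⁻¹ *
      ((Finset.univ.filter fun t : Fin R => par N R M (x.1 - tstep (fine (R * N) M) x.2 (t : ℕ)) = i.1).card : ℝ) else 0 := by
  rw [QB_apply_eq_card]
  split_ifs
  · rw [show ((R : ℂ) ^ (d + 1))⁻¹ = ((((R : ℝ) ^ (d + 1))⁻¹ : ℝ) : ℂ) by push_cast; rfl, ← Complex.ofReal_natCast, ← Complex.ofReal_mul,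
      Complex.ofReal_re]
  · rfl

/-- `0 ≤ QB_{ix}` (entrywise). [folklore] -/
theorem re_QB_nonneg (i : Tor (fine N M) × Fin d) (x : Tor (fine (R * N) M) × Fin d) : 0 ≤ (QB N R M i x).re := by
  rw [re_QB_eq_card]
  split_ifs
  · positivity
  · exact le_rfl

/-- `QB_{ix} ≤ R^{−d}` (at most `R` contours through a fine bond are counted at one coarse bond). [folklore] -/
theorem re_QB_le (i : Tor (fine N M) × Fin d) (x : Tor (fine (R * N) M) × Fin d) : (QB N R M i x).re ≤ ((R : ℝ) ^ d)⁻¹ := by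
  have hR : (0 : ℝ) < R := by exact_mod_cast Nat.pos_of_ne_zero (NeZero.ne R)
  rw [re_QB_eq_card]
  split_ifs
  · have hc : ((Finset.univ.filter fun t : Fin R => par N R M (x.1 - tstep (fine (R * N) M) x.2 (t : ℕ)) = i.1).card : ℝ) ≤ R := by
      have h1 := Finset.card_filter_le (Finset.univ : Finset (Fin R))
        (fun t : Fin R => par N R M (x.1 - tstep (fine (R * N) M) x.2 (t : ℕ)) = i.1)
      rw [Finset.card_univ, Fintype.card_fin] at h1
      exact_mod_cast h1
    calc ((R : ℝ) ^ (d + 1))⁻¹ * _ ≤ ((R : ℝ) ^ (d + 1))⁻¹ * R := mul_le_mul_of_nonneg_left hc (by positivity)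
      _ = ((R : ℝ) ^ d)⁻¹ := by rw [pow_succ, mul_inv, mul_assoc, inv_mul_cancel₀ hR.ne', mul_one]
  · positivity

end Entries

/-! ## §2 Row and column sums -/

section Sums

/-- **ROW MASS ONE**: `Σ_{x′} QB_{(y,μ),x′} = 1` (every row of Bałaban's averaging is a probability vector: `R^{d}·R` contour bonds of weight `R^{−(d+1)}`;
`QB·J₀′ = J₀`). [cite: Balaban1984PropagatorsI, (1.18) p.20, (1.74) p.30] [folklore] -/
theorem sum_QB_row (i : Tor (fine N M) × Fin d) : ∑ x, QB N R M i x = 1 := by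
  have h := congrFun (QB_mulVec_constV N R M (fun _ => (1 : ℂ))) i
  simpa only [Matrix.mulVec, dotProduct, constV, mul_one] using h

/-- **COLUMN MASS `R^{−d}`**: `Σ_{(y,μ)} QB_{(y,μ),x′} = R^{−d}` (every fine bond lies on exactly `R` counted contours; `QBᴴ·J₀ = R^{−d}·J₀′`). [folklore] -/
theorem sum_QB_col (x : Tor (fine (R * N) M) × Fin d) : ∑ i, QB N R M i x = ((R : ℂ) ^ d)⁻¹ := by
  have h := congrFun (QB_conjTranspose_mulVec_constV N R M (fun _ => (1 : ℂ))) x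
  simp only [Matrix.mulVec, dotProduct, constV, mul_one, Matrix.conjTranspose_apply, Pi.smul_apply, smul_eq_mul] at h
  rw [← h]
  refine Finset.sum_congr rfl fun i _ => ?_
  rw [Complex.star_def, isReal_QB]

/-- the real row mass: `Σ_{x′} re QB_{(y,μ),x′} = 1`. [folklore] -/
theorem sum_re_QB_row (i : Tor (fine N M) × Fin d) : ∑ x, (QB N R M i x).re = 1 := by
  rw [← Complex.re_sum, sum_QB_row, Complex.one_re]

/-- **PART 105 §4's row-mass letter with `q₁ = 1`**: `Σ_{x′} |re QB_{(y,μ),x′}| = 1`. [folklore] -/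
theorem sum_abs_reM_QB_row (i : Tor (fine N M) × Fin d) : ∑ x, |reM (QB N R M) i x| = 1 := by
  rw [← sum_re_QB_row N R M i]
  exact Finset.sum_congr rfl fun x _ => by rw [reM_apply, abs_of_nonneg (re_QB_nonneg N R M i x)]

/-- the real column mass: `Σ_{(y,μ)} re QB_{(y,μ),x′} = R^{−d}`. [folklore] -/
theorem sum_re_QB_col (x : Tor (fine (R * N) M) × Fin d) : ∑ i, (QB N R M i x).re = ((R : ℝ) ^ d)⁻¹ := by
  rw [← Complex.re_sum, sum_QB_col]
  rw [show ((R : ℂ) ^ d)⁻¹ = ((((R : ℝ) ^ d)⁻¹ : ℝ) : ℂ) by push_cast; rfl, Complex.ofReal_re]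

end Sums

/-! ## §3 The corner lift: an explicit right inverse of `re QB` with computable mass -/

section Lift

/-- **REPARAMETRISATION OF THE FINE TORUS BY (PARENT, OFFSET)**: `Σ_{x′} f(x′) = Σ_y Σ_j f(R·y + j)` (the `R`-blocks tile the fine torus; `x′ ↦ (par x′, rem x′)` and
`(y, j) ↦ R·y + j` are inverse bijections). [cite: King1986, (2.10) p.653] [folklore] -/
theorem sum_eq_sum_par_off {α : Type*} [AddCommMonoid α] (f : Tor (fine (R * N) M) → α) :
    ∑ w, f w = ∑ y : Tor (fine N M), ∑ j : Fin d → Fin R, f (cpt N R M y + off N R M j) := by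
  let e : Tor (fine (R * N) M) ≃ Tor (fine N M) × (Fin d → Fin R) :=
    { toFun := fun w => (par N R M w, rem N R M w)
      invFun := fun p => cpt N R M p.1 + off N R M p.2
      left_inv := fun w => cpt_par_add_off_rem N R M w
      right_inv := fun p => Prod.ext (par_cpt_add_off N R M p.1 p.2) (rem_cpt_add_off N R M p.1 p.2) }
  rw [← Fintype.sum_prod_type']
  exact Fintype.sum_equiv e _ _ fun w => by simp only [e, Equiv.coe_fn_mk, cpt_par_add_off_rem]

/-- the TOP-CORNER mask `rem x′ ≡ R − 1` singles out exactly one offset: `Σ_j [∀ ν, j_ν = R − 1]·g(j) = g(R−1, …, R−1)`. [folklore] -/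
theorem sum_ite_forall_eq (g : (Fin d → Fin R) → ℝ) :
    ∑ j : Fin d → Fin R, (if (∀ ν, ((j ν : ℕ)) = R - 1) then g j else 0)
      = g (fun _ => ⟨R - 1, Nat.sub_lt (Nat.pos_of_ne_zero (NeZero.ne R)) Nat.one_pos⟩) := by
  rw [Finset.sum_eq_single (fun _ => ⟨R - 1, Nat.sub_lt (Nat.pos_of_ne_zero (NeZero.ne R)) Nat.one_pos⟩ : Fin d → Fin R)]
  · rw [if_pos]; intro ν; rfl
  · intro j _ hj
    rw [if_neg]
    intro h
    exact hj (funext fun ν => Fin.ext (h ν))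
  · intro h; exact absurd (Finset.mem_univ _) h

/-- **`reM_QB_mulVec_cornerLift` — THE CORNER LIFT IS A RIGHT INVERSE OF BAŁABAN's AVERAGING**: the fine field carrying `R^d·B(y,μ)` on the single bond `(R·y + (R−1,…,R−1), μ)`
at the top corner of each block (and `0` elsewhere) averages back to `B`: `(re QB)·lift B = B` — that bond lies on `R` counted contours, all starting in `B(y)`, each of weight
`R^{−(d+1)}`.  One trial field per coarse datum (PART 105's `hUB` shape). [folklore] -/
theorem reM_QB_mulVec_cornerLift (B : Tor (fine N M) × Fin d → ℝ) :
    reM (QB N R M) *ᵥ (fun x => if (∀ ν, ((rem N R M x.1 ν : ℕ)) = R - 1) then (R : ℝ) ^ d * B (par N R M x.1, x.2) else 0) = B := by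
  have hR : 0 < R := Nat.pos_of_ne_zero (NeZero.ne R)
  have hRd : ((R : ℝ) ^ d) ≠ 0 := pow_ne_zero _ (by exact_mod_cast hR.ne')
  funext i
  simp only [Matrix.mulVec, dotProduct]
  rw [Fintype.sum_prod_type, sum_eq_sum_par_off N R M]
  simp only [rem_cpt_add_off, par_cpt_add_off]
  have hj : ∀ y : Tor (fine N M), (∑ j : Fin d → Fin R, ∑ μ' : Fin d,
      reM (QB N R M) i (cpt N R M y + off N R M j, μ') * (if (∀ ν, ((j ν : ℕ)) = R - 1) then (R : ℝ) ^ d * B (y, μ') else 0))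
      = ∑ μ' : Fin d, (if (y, μ') = i then ((R : ℝ) ^ d)⁻¹ else 0) * ((R : ℝ) ^ d * B (y, μ')) := by
    intro y
    have hswap : ∀ j : Fin d → Fin R, (∑ μ' : Fin d,
        reM (QB N R M) i (cpt N R M y + off N R M j, μ') * (if (∀ ν, ((j ν : ℕ)) = R - 1) then (R : ℝ) ^ d * B (y, μ') else 0))
        = if (∀ ν, ((j ν : ℕ)) = R - 1) then ∑ μ' : Fin d, reM (QB N R M) i (cpt N R M y + off N R M j, μ') * ((R : ℝ) ^ d * B (y, μ')) else 0 := by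
      intro j
      split_ifs
      · rfl
      · simp
    simp_rw [hswap]
    rw [sum_ite_forall_eq]
    refine Finset.sum_congr rfl fun μ' _ => ?_
    congr 1
    rw [reM_apply, QB_apply_of_rem_eq N R M (by rw [rem_cpt_add_off]), par_cpt_add_off]
    split_ifs
    · rw [show ((R : ℂ) ^ d)⁻¹ = ((((R : ℝ) ^ d)⁻¹ : ℝ) : ℂ) by push_cast; rfl, Complex.ofReal_re]
    · rfl
  simp_rw [hj]
  rw [← Fintype.sum_prod_type' (f := fun (y : Tor (fine N M)) (μ' : Fin d) => (if (y, μ') = i then ((R : ℝ) ^ d)⁻¹ else 0) * ((R : ℝ) ^ d * B (y, μ')))]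
  simp only [ite_mul, zero_mul, Prod.mk.eta, Finset.sum_ite_eq', Finset.mem_univ, if_true]
  rw [← mul_assoc, inv_mul_cancel₀ hRd, one_mul]

/-- **THE MASS OF THE CORNER LIFT**: `|lift B|² = R^{2d}·|B|²` (exactly one corner bond per (block, component)). [folklore] -/
theorem cornerLift_dotProduct_self (B : Tor (fine N M) × Fin d → ℝ) :
    (fun x : Tor (fine (R * N) M) × Fin d => if (∀ ν, ((rem N R M x.1 ν : ℕ)) = R - 1) then (R : ℝ) ^ d * B (par N R M x.1, x.2) else 0) ⬝ᵥ
      (fun x => if (∀ ν, ((rem N R M x.1 ν : ℕ)) = R - 1) then (R : ℝ) ^ d * B (par N R M x.1, x.2) else 0)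
      = ((R : ℝ) ^ d) ^ 2 * (B ⬝ᵥ B) := by
  simp only [dotProduct]
  rw [Fintype.sum_prod_type, sum_eq_sum_par_off N R M]
  simp only [rem_cpt_add_off, par_cpt_add_off]
  have hj : ∀ y : Tor (fine N M), (∑ j : Fin d → Fin R, ∑ μ' : Fin d,
      (if (∀ ν, ((j ν : ℕ)) = R - 1) then (R : ℝ) ^ d * B (y, μ') else 0) * (if (∀ ν, ((j ν : ℕ)) = R - 1) then (R : ℝ) ^ d * B (y, μ') else 0))
      = ∑ μ' : Fin d, ((R : ℝ) ^ d) ^ 2 * (B (y, μ') * B (y, μ')) := by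
    intro y
    have hswap : ∀ j : Fin d → Fin R, (∑ μ' : Fin d,
        (if (∀ ν, ((j ν : ℕ)) = R - 1) then (R : ℝ) ^ d * B (y, μ') else 0) * (if (∀ ν, ((j ν : ℕ)) = R - 1) then (R : ℝ) ^ d * B (y, μ') else 0))
        = if (∀ ν, ((j ν : ℕ)) = R - 1) then ∑ μ' : Fin d, ((R : ℝ) ^ d) ^ 2 * (B (y, μ') * B (y, μ')) else 0 := by
      intro j
      split_ifs
      · exact Finset.sum_congr rfl fun μ' _ => by ring
      · simp
    simp_rw [hswap]
    rw [sum_ite_forall_eq]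
  simp_rw [hj]
  rw [← Fintype.sum_prod_type' (f := fun (y : Tor (fine N M)) (μ' : Fin d) => ((R : ℝ) ^ d) ^ 2 * (B (y, μ') * B (y, μ'))), ← Finset.mul_sum]

/-- **`ub_QB` — PART 105's UPPER BOUND IN TRIAL FORM FOR BAŁABAN's AVERAGING**: if the fine form is bounded above, `⟨u, H_fu⟩ ≤ h·|u|²` (`h ≥ 0`), then every coarse datum `B` has a
fine field `u` with `(re QB)·u = B` and `⟨u, H_fu⟩ ≤ h·R^{2d}·|B|²` — the letter `hUB` of `EffectiveFormLocalisation.blockProp_coercive_of_ub` ∕ `abs_effForm_le` ∕ `abs_minOp_le` and of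
PART 106 `FluctuationCovarianceLocalisation.abs_flucCov_le`, with `Λ = h·R^{2d}`. [folklore] -/
theorem ub_QB {H : Matrix (Tor (fine (R * N) M) × Fin d) (Tor (fine (R * N) M) × Fin d) ℝ} {h : ℝ}
    (hH : ∀ u, u ⬝ᵥ (H *ᵥ u) ≤ h * (u ⬝ᵥ u)) (B : Tor (fine N M) × Fin d → ℝ) :
    ∃ u : Tor (fine (R * N) M) × Fin d → ℝ, reM (QB N R M) *ᵥ u = B ∧ u ⬝ᵥ (H *ᵥ u) ≤ h * ((R : ℝ) ^ d) ^ 2 * (B ⬝ᵥ B) :=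
  ⟨fun x => if (∀ ν, ((rem N R M x.1 ν : ℕ)) = R - 1) then (R : ℝ) ^ d * B (par N R M x.1, x.2) else 0, reM_QB_mulVec_cornerLift N R M B,
    (hH _).trans (by rw [cornerLift_dotProduct_self, mul_assoc])⟩

/-- **ONTO, QUANTITATIVELY**: `|B|² ≤ R^{2d}·|(re QB)ᵀB|²·` — precisely `|B| ≤ R^d·|(re QB)ᵀ B|`, i.e. the smallest singular value of Bałaban's averaging is at least `R^{−d}`
(`B = (re QB)(lift B)`, Cauchy–Schwarz against the corner lift). [folklore] -/
theorem dotProduct_self_le_transpose_QB (B : Tor (fine N M) × Fin d → ℝ) :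
    B ⬝ᵥ B ≤ ((R : ℝ) ^ d) ^ 2 * (((reM (QB N R M))ᵀ *ᵥ B) ⬝ᵥ ((reM (QB N R M))ᵀ *ᵥ B)) := by
  set u : Tor (fine (R * N) M) × Fin d → ℝ :=
    fun x => if (∀ ν, ((rem N R M x.1 ν : ℕ)) = R - 1) then (R : ℝ) ^ d * B (par N R M x.1, x.2) else 0 with hu
  set w : Tor (fine (R * N) M) × Fin d → ℝ := (reM (QB N R M))ᵀ *ᵥ B with hw
  have hQu : reM (QB N R M) *ᵥ u = B := reM_QB_mulVec_cornerLift N R M B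
  have huu : u ⬝ᵥ u = ((R : ℝ) ^ d) ^ 2 * (B ⬝ᵥ B) := cornerLift_dotProduct_self N R M B
  -- `|B|² = ⟨QB u, B⟩ = ⟨u, QBᵀ B⟩`
  have hBB : B ⬝ᵥ B = u ⬝ᵥ w := by
    rw [hw, dotProduct_mulVec u (reM (QB N R M))ᵀ B, vecMul_transpose, hQu]
  -- `0 ≤ |u − s•w|²` with `s = R^{2d}` reads `s|B|² ≤ s²|w|²`
  have hs : 0 < ((R : ℝ) ^ d) ^ 2 := by
    have hR : (0 : ℝ) < R := by exact_mod_cast Nat.pos_of_ne_zero (NeZero.ne R)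
    positivity
  have h0 : 0 ≤ (u - (((R : ℝ) ^ d) ^ 2) • w) ⬝ᵥ (u - (((R : ℝ) ^ d) ^ 2) • w) := by
    rw [dotProduct]; exact Finset.sum_nonneg fun i _ => mul_self_nonneg _
  rw [sub_dotProduct, dotProduct_sub, dotProduct_sub, dotProduct_smul, smul_dotProduct, smul_dotProduct, dotProduct_smul] at h0
  simp only [smul_eq_mul] at h0
  rw [huu, dotProduct_comm w u, ← hBB] at h0
  nlinarith [h0, hs]

end Lift

end Summit.QuantumFields.BalabanUV.Beta.GAN24.OneStepConstraintLetters

end
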